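import Literature.AnabelianGeometry.EtaleTheta.Setting
import Literature.AnabelianGeometry.EtaleTheta.ContH1
import Literature.AnabelianGeometry.EtaleTheta.ClassicalTheta
import HarnessLib

/-!
# [EtTh] §1: the étale theta class — Prop. 1.3 and Rmk. 1.3.1 (data and cohomology for Props. 1.4–1.5)

Mochizuki, *The étale theta function …*, Publ. RIMS **45** (2009), §1, PRIMS PDF pp. 19–23 (printed
245–249) [cite: MochizukiEtTh2009, Prop 1.3 p.19]. Layer L2 of the abc-iut cell, seat abc-iut-L2-t1.
Typed OVER `ThetaSetting p` (the L2 root `Setting.lean`, which extends the tree's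
`SemiGraphs.TemperedCurve p`) and the concrete continuous `H¹` of `ContH1.lean`; the classical theta
series is `ClassicalTheta.thetaDdot`. THIS file: the real cohomology groups, the Kummer / étale-theta
DATA interfaces, Prop. 1.3 and Rmk. 1.3.1. The COMPANION file `ThetaCohomology.lean` (imports this
one) types Prop. 1.4 (iii) and Prop. 1.5 (i)–(iii) (`Prop14iiiKummer`, `Prop14iiiValues`, `Prop15i`,
`Prop15ii`, `Prop15iii`) over the same data.

**How the statements are typed.** The cohomology groups `H¹(Π^tp_Ÿ, Δ_Θ)`, `H¹((Π^tp_Ÿ)^Θ, Δ_Θ)`,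
`H¹((Π^tp_Y)^Θ, Δ_Θ)`, `Hom(Δ_Θ, Δ_Θ)` of pp. 20–23 are REAL (`ThetaSetting.H1`, `.H1Theta`, via
`ContH1`), as are restriction / inflation / the conjugation action of `Z ≅ Π^tp_X/Π^tp_Y` and the
class `log(Θ)` (the identity `Δ_Θ → Δ_Θ`, p. 23). What Mathlib cannot yet supply is carried as DATA
with printed properties: Kummer theory and local class field theory enter through `KummerData`
(the profinite completions `(K^×)^∧ ⊆ (K̈^×)^∧`, the injections
`(K̈^×)^∧ ≅ H¹(G_K̈, Ẑ(1)) ≅ H¹(G_K̈, Δ_Θ) ↪ H¹((Π^tp_Ÿ)^Θ, Δ_Θ)` = `F̈²` of Prop. 1.5 (ii), the Kummer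
classes `log(U)`, `log(Ü)` of the coordinates — plan/FOUNDATIONS.md rows 10, 15; TODO-merge(abc-iut-L2-t3) general Kummer map N13); the
level-`N` classes `η^Θ_N ∈ H¹(Π^tp_Y, Δ_Θ ⊗ ½ℤ/Nℤ)` and their limit in `H¹(Π^tp_Y, ½Δ_Θ)` (p. 20),
whose coefficient modules have no carrier here, are abstract groups in `EtaleThetaData`; the class
"without denominators" `η̈^Θ ∈ H¹(Π^tp_Ÿ, Δ_Θ)` (p. 21) — THE object IUT consumes — is a genuine element
of the real `H¹`. Each printed sub-item is then ONE `Prop`-valued predicate on these data (here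
`Prop13`, `Rmk131`; in the companion file `Prop14iii…`, `Prop15…`); nothing is asserted.

Containments the statements invoke but `Setting.lean` does not record: `ThetaSetting.Compat`.
READING NOTES (recorded, not resolved): p. 20 prints "the natural isomorphism `(Δ^tp_Y)^Θ →̃ Δ_Θ`" and
p. 23 "`F¹/F² = Hom((Δ^tp_Y)^ell/Δ_Θ, Δ_Θ)`", while p. 12 gives `1 → Δ_Θ → (Δ^tp_Y)^Θ → (Δ^tp_Y)^ell → 1`;
the unambiguous readings are typed (restriction to `Δ_Θ` is `log(Θ)`; `F¹`, `F²` as kernels).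
Deliberately NOT typed (no carrier; nothing silently dropped): Prop. 1.4 (i)'s "divisor of poles
`= D₁`" and Rmk. 1.3.1's reason (formal-scheme divisors), the cusp clause of Prop. 1.4 (iii) ([GalSect]
Def. 4.1 (iii), layer L4), the independence of `O^×_{K/K̈} · η^Θ_N` from the choices `s₁, s_N, τ_N`
(Prop. 1.1 / Lem. 1.2 live in `ThetaTrivializations.lean`), the inversion clause of Prop. 1.5 (iii),
"`= Ẑ · log`" identifications. HONEST FRAMING: [EtTh] is refereed; typed ≠ proved; no side taken.
-/

noncomputable section

namespace Literature.AnabelianGeometry.EtaleTheta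

open Literature.AnabelianGeometry.SemiGraphs

namespace ThetaSetting

variable {p : ℕ} [Fact p.Prime] (D : ThetaSetting p)

/-! ### First consequences of the root axioms: the theta-quotient kernels lie in `Δ^tp_X` -/

/-- **`Π^tp_X ∩ Δ_X = Δ^tp_X` inside `Π_X`** (p. 12: the rows `1 → Δ^tp_X → Π^tp_X → G_K → 1` and
`Π_X ↠ G_K` have the same quotient) — PROVED from the parent interface (`augHat ∘ toHat = aug`; the
kernel of `augHat` is closed). Referee finding A2-F4, now a theorem. [cite: MochizukiEtTh2009, §1 p.12] -/
theorem comap_toHat_deltaHat : D.DeltaHat.comap D.toHat.toMonoidHom = D.DeltaTemp := by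
  apply le_antisymm
  · intro x hx
    have hker : IsClosed ((D.augHat.toMonoidHom.ker : Subgroup D.PiHat) : Set D.PiHat) := by
      have h1 : ((D.augHat.toMonoidHom.ker : Subgroup D.PiHat) : Set D.PiHat) = D.augHat ⁻¹' {1} := by
        ext y
        simp [MonoidHom.mem_ker]
      rw [h1]
      exact isClosed_singleton.preimage (map_continuous D.augHat)
    have hle : D.DeltaTemp.map D.toHat.toMonoidHom ≤ D.augHat.toMonoidHom.ker := by
      rintro _ ⟨y, hy, rfl⟩
      have hy' : D.aug y = 1 := hy
      simp [MonoidHom.mem_ker, D.augHat_comp, hy']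
    have hx' := (Subgroup.topologicalClosure_minimal _ hle hker) hx
    have : D.aug x = 1 := by simpa [MonoidHom.mem_ker, D.augHat_comp] using hx'
    exact this
  · intro x hx
    exact Subgroup.le_topologicalClosure _ ⟨x, hx, rfl⟩

/-- `[Δ_X, Δ_X]⁻ ⊆ Δ_X` (`Δ_X` is a closed subgroup of `Π_X`, p. 12). [cite: MochizukiEtTh2009, §1 p.12] -/
theorem commutatorClosure_le_deltaHat :
    (⁅D.DeltaHat, D.DeltaHat⁆).topologicalClosure ≤ D.DeltaHat :=
  Subgroup.topologicalClosure_minimal _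
    (Subgroup.commutator_le.2 fun a ha b hb => by
      rw [commutatorElement_def]
      exact D.DeltaHat.mul_mem (D.DeltaHat.mul_mem (D.DeltaHat.mul_mem ha hb)
        (D.DeltaHat.inv_mem ha)) (D.DeltaHat.inv_mem hb))
    (Subgroup.isClosed_topologicalClosure (D.DeltaTemp.map D.toHat.toMonoidHom))

/-- `[Δ_X, [Δ_X, Δ_X]]⁻ ⊆ Δ_X` (p. 12). [cite: MochizukiEtTh2009, §1 p.12] -/
theorem tripleCommutatorClosure_le_deltaHat :
    (⁅⁅D.DeltaHat, D.DeltaHat⁆, D.DeltaHat⁆).topologicalClosure ≤ D.DeltaHat :=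
  Subgroup.topologicalClosure_minimal _
    (Subgroup.commutator_le.2 fun a ha b hb => by
      rw [commutatorElement_def]
      have ha' : a ∈ D.DeltaHat :=
        D.commutatorClosure_le_deltaHat (Subgroup.le_topologicalClosure _ ha)
      exact D.DeltaHat.mul_mem (D.DeltaHat.mul_mem (D.DeltaHat.mul_mem ha' hb)
        (D.DeltaHat.inv_mem ha')) (D.DeltaHat.inv_mem hb))
    (Subgroup.isClosed_topologicalClosure (D.DeltaTemp.map D.toHat.toMonoidHom))

/-- `Ker(Π^tp_X ↠ (Π^tp_X)^Θ) ⊆ Δ^tp_X`: the theta-quotient kernel IS a subgroup of the geometric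
tempered fundamental group, as printed (p. 12 "the kernels of the quotients `Δ^tp_X ↠ (Δ^tp_X)^Θ`")
— PROVED. [cite: MochizukiEtTh2009, §1 p.12] -/
theorem ker_toTheta_le_deltaTemp : D.toTheta.ker ≤ D.DeltaTemp := by
  rw [D.ker_toTheta, ← D.comap_toHat_deltaHat]
  exact Subgroup.comap_mono D.tripleCommutatorClosure_le_deltaHat

/-- `Ker(Π^tp_X ↠ (Π^tp_X)^ell) ⊆ Δ^tp_X` (p. 12) — PROVED. [cite: MochizukiEtTh2009, §1 p.12] -/
theorem ker_toEll_le_deltaTemp : (D.thetaToEll.comp D.toTheta).ker ≤ D.DeltaTemp := by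
  rw [D.ker_toEll, ← D.comap_toHat_deltaHat]
  exact Subgroup.comap_mono D.commutatorClosure_le_deltaHat

/-! ### The coefficient group `Δ_Θ` and the cohomology groups of §1 (real) -/

/-- `Δ_Θ = Ker((Π^tp_X)^Θ ↠ (Π^tp_X)^ell)` is normal in `(Π^tp_X)^Θ`. [cite: MochizukiEtTh2009, §1 p.12] -/
instance deltaTheta_normal : D.DeltaTheta.Normal :=
  inferInstanceAs D.thetaToEll.ker.Normal

/-- `Δ_Θ (≅ Ẑ(1))` is commutative (p. 12; field `ker_thetaToEll_comm`). [cite: MochizukiEtTh2009, §1 p.12] -/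
instance deltaTheta_comm : IsMulCommutative D.DeltaTheta :=
  ⟨⟨fun a b => Subtype.ext (D.ker_thetaToEll_comm a.1 a.2 b.1 b.2)⟩⟩

/-- `H¹(H, Δ_Θ)` for a subgroup `H ≤ Π^tp_X` (e.g. `Π^tp_Ÿ`, `Π^tp_Y`), `Π^tp_X` acting on `Δ_Θ` by
conjugation through `Π^tp_X ↠ (Π^tp_X)^Θ` (pp. 20–22). [cite: MochizukiEtTh2009, Prop 1.3 p.21] -/
abbrev H1 (H : Subgroup D.PiTemp) : Type := ContH1 D.toTheta D.DeltaTheta H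

/-- `H¹(H', Δ_Θ)` for a subgroup `H' ≤ (Π^tp_X)^Θ` (e.g. `(Π^tp_Ÿ)^Θ`, `(Δ^tp_Y)^Θ`, `Δ_Θ`), the theta
quotient acting on `Δ_Θ` by conjugation (Prop. 1.5, pp. 22–23). [cite: MochizukiEtTh2009, Prop 1.5 p.22] -/
abbrev H1Theta (H' : Subgroup D.GtpTheta) : Type :=
  ContH1 (MonoidHom.id D.GtpTheta) D.DeltaTheta H'

/-- Inflation `H¹(H^Θ, Δ_Θ) → H¹(H, Δ_Θ)` along `H ↠ H^Θ := ` image of `H` in `(Π^tp_X)^Θ` ("arises from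
a unique class", Prop. 1.5 (iii), p. 23). [cite: MochizukiEtTh2009, Prop 1.5 (iii) p.23] -/
def inflTheta (H : Subgroup D.PiTemp) : D.H1Theta (H.map D.toTheta) →* D.H1 H :=
  ContH1.infl D.DeltaTheta D.toTheta D.continuous_toTheta le_rfl

/-- **`log(Θ)`** ∈ `Hom(Δ_Θ, Δ_Θ) = H¹(Δ_Θ, Δ_Θ)`: "we use the symbol `log(Θ)` to denote the identity
morphism `Δ_Θ → Δ_Θ`" (p. 23) — the class of the identity cocycle (a cocycle because `Δ_Θ` is abelian).
[cite: MochizukiEtTh2009, Prop 1.5 (i) p.23] -/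
def logTheta : D.H1Theta D.DeltaTheta :=
  ContH1.mk (fun x => x) ⟨continuous_id, fun g h => by
    apply Subtype.ext
    simp only [Subgroup.coe_mul, MulAut.conjNormal_apply, MonoidHom.id_apply]
    conv_rhs => rw [← D.ker_thetaToEll_comm h.1 h.2 g.1 g.2]
    simp only [mul_inv_cancel_right]⟩

/-- `Π^tp_Ÿ ≤ Π^tp_Y` (`Ÿ → Y`, p. 17). [cite: MochizukiEtTh2009, §1 p.17] -/
theorem GtpYdd_le_GtpY : D.GtpYdd ≤ D.GtpY :=
  (inf_le_left : D.GtpYddN 1 ≤ D.GtpYN (2 * 1)).trans (D.GtpYN_le _)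

/-- `(Π^tp_Ÿ)^Θ ≤ (Π^tp_Y)^Θ`. [cite: MochizukiEtTh2009, §1 p.17] -/
theorem GtpYddTheta_le : D.GtpYdd.map D.toTheta ≤ D.GtpY.map D.toTheta :=
  Subgroup.map_mono D.GtpYdd_le_GtpY

/-- The subgroup `O^×_{K/K̈} := {a ∈ O^×_K̈ | a² ∈ K}` of `K̈^×` (Prop. 1.3, p. 20).
[cite: MochizukiEtTh2009, Prop 1.3 p.20] -/
def unitsOKmodKdd : Subgroup (↥D.Kdd)ˣ where
  carrier := {a | a ∈ D.unitsOKdd ∧ ((a : D.Kdd) : PadicAlgCl p) ^ 2 ∈ D.K}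
  one_mem' := ⟨one_mem _, by simp⟩
  mul_mem' := by
    rintro a b ⟨ha, hx⟩ ⟨hb, hy⟩
    refine ⟨mul_mem ha hb, ?_⟩
    have : (((a * b : (↥D.Kdd)ˣ) : D.Kdd) : PadicAlgCl p) ^ 2 =
        ((a : D.Kdd) : PadicAlgCl p) ^ 2 * ((b : D.Kdd) : PadicAlgCl p) ^ 2 := by
      push_cast; ring
    rw [this]
    exact D.K.mul_mem hx hy
  inv_mem' := by
    rintro a ⟨ha, hx⟩
    refine ⟨inv_mem ha, ?_⟩
    have : (((a⁻¹ : (↥D.Kdd)ˣ) : D.Kdd) : PadicAlgCl p) ^ 2 =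
        (((a : D.Kdd) : PadicAlgCl p) ^ 2)⁻¹ := by
      rw [Units.val_inv_eq_inv_val]; push_cast; ring
    rw [this]
    exact D.K.inv_mem hx

/-- `q̈ ∈ K̈ = K(ζ₂, q_X^{1/2})` (p. 17) — PROVED from the definition of `K̈ = K₂`.
[cite: MochizukiEtTh2009, §1 p.17] -/
theorem qdd_mem_Kdd : D.qdd ∈ D.Kdd := by
  apply IntermediateField.subset_adjoin
  right
  right
  simpa using D.sqrtqX_sq

/-- `q̈ ≠ 0` (since `q̈² = q_X ≠ 0`). [cite: MochizukiEtTh2009, §1 p.17] -/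
theorem qdd_ne_zero : D.qdd ≠ 0 := by
  intro h
  apply D.qX_ne_zero
  rw [← D.sqrtqX_sq, show D.sqrtqX = D.qdd from rfl, h, zero_pow two_ne_zero]

/-- `q̈ = q_X^{1/2}` as a unit of `K̈`. [cite: MochizukiEtTh2009, §1 p.17] -/
def qddUnit : (↥D.Kdd)ˣ :=
  Units.mk0 ⟨D.qdd, D.qdd_mem_Kdd⟩ (by
    intro h
    exact D.qdd_ne_zero (congrArg Subtype.val h))

/-- `J̈₁ = K̈₁(a^{1/1}) = K₂` ("`K̈ := K̈₁ = J̈₁ = K₂`", p. 17) — PROVED from the definitions of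
`fieldJddN` / `fieldKN`. [cite: MochizukiEtTh2009, §1 p.17] -/
theorem fieldJddN_one (K : IntermediateField ℚ_[p] (PadicAlgCl p)) (q : PadicAlgCl p) :
    fieldJddN K q 1 = fieldKN K q 2 := by
  unfold fieldJddN
  have h2 : (2 * 1 : ℕ+) = 2 := rfl
  rw [h2]
  apply le_antisymm
  · rw [IntermediateField.adjoin_le_iff]
    rintro x (hx | hx)
    · exact hx
    · simpa using hx
  · exact fun x hx => IntermediateField.subset_adjoin _ _ (Or.inl hx)

/-- `G_{J̈₁} = G_{K₂} = G_K̈` (p. 17) — PROVED. [cite: MochizukiEtTh2009, §1 p.17] -/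
theorem GJddN_one : D.GJddN 1 = D.GKN 2 := by
  unfold ThetaSetting.GJddN ThetaSetting.GKN
  rw [fieldJddN_one]

/-- **Containments among the §1 subgroups** that the statements below invoke and that the root file
does not record; each is a printed sentence. [cite: MochizukiEtTh2009, Prop 1.5 p.22] -/
structure Compat : Prop where
  /-- "`Δ_Θ ⊆ (Δ^tp_Y)^Θ ⊆ (Π^tp_Y)^Θ`", "the filtration of closed subgroups" of Prop. 1.5 (i) (p. 22). -/
  deltaTheta_le_DtpYTheta : D.DeltaTheta ≤ D.DtpYTheta
  /-- "`Δ_Θ ⊆ (Δ^tp_Ÿ)^Θ ⊆ (Π^tp_Ÿ)^Θ`", Prop. 1.5 (ii) (p. 23). -/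
  deltaTheta_le_DtpYddTheta : D.DeltaTheta ≤ (D.DtpYddN 1).map D.toTheta
  /-- `K̈/K` is Galois (degree `≤ 2`): the pull-back of `G_K̈ = G_{K₂}` to `Π^tp_X` (whose image is `G_K`)
  is normal (used when `Π^tp_X/Π^tp_Y` acts on classes of `Π^tp_Ÿ`, Prop. 1.5 (iii), Thm. 1.6 (iii)). -/
  GKdd_normal : ((D.GKN 2).comap D.aug.toMonoidHom).Normal

/-- `Ÿ → X` is Galois: `Π^tp_Ÿ` is normal in `Π^tp_X` (the text lets `Π^tp_X/Π^tp_Y ≅ Z` act on classes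
of `Π^tp_Ÿ`, Prop. 1.5 (iii) p. 23, Thm. 1.6 (iii) p. 24) — PROVED from the root axioms and
`K̈ = J̈₁ = K₂` (`GJddN_one`): `Π^tp_Ÿ = Π^tp_{Y₂} ∩ aug⁻¹(G_{K₂})`, both normal. [cite: MochizukiEtTh2009, Prop 1.5 (iii) p.23] -/
theorem Compat.GtpYdd_normal (hC : D.Compat) : D.GtpYdd.Normal := by
  haveI := D.GtpYN_normal (2 * 1)
  haveI : ((D.GJddN 1).comap D.aug.toMonoidHom).Normal := by
    rw [D.GJddN_one]
    exact hC.GKdd_normal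
  exact Subgroup.normal_inf_normal _ _

/-- Hence `(Π^tp_Ÿ)^Θ` is normal in `(Π^tp_X)^Θ` (image of a normal subgroup under the surjection
`Π^tp_X ↠ (Π^tp_X)^Θ`) — PROVED. [cite: MochizukiEtTh2009, Prop 1.5 (iii) p.23] -/
theorem Compat.GtpYddTheta_normal (hC : D.Compat) : (D.GtpYdd.map D.toTheta).Normal :=
  hC.GtpYdd_normal.map D.toTheta D.toTheta_surjective

/-! ### Kummer-theoretic data (interface; Kummer theory / LCFT not in scope here) -/

/-- **Kummer data** for the §1 setting — the objects through which `K^×`, `K̈^×`, their units and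
the coordinates `U`, `Ü` enter the cohomology groups (pp. 20–23): the profinite completions
`(K^×)^∧ ⊆ (K̈^×)^∧` ("where the `∧` denotes the profinite completion", p. 22), the composite injections
`(K^×)^∧ ≅ H¹(G_K, Ẑ(1)) ≅ H¹(G_K, Δ_Θ) = F² ⊆ H¹((Π^tp_Y)^Θ, Δ_Θ)` and
`(K̈^×)^∧ ≅ H¹(G_K̈, Δ_Θ) = F̈² ⊆ H¹((Π^tp_Ÿ)^Θ, Δ_Θ)` of Prop. 1.5 (i), (ii) (Kummer theory + inflation;
"the composite of the Kummer map `O^×_K̈ → H¹(G_K̈, Δ_Θ)` with the natural map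
`H¹(G_K̈, Δ_Θ) → H¹(Π^tp_Ÿ, Δ_Θ)`", p. 21), the Kummer classes `log(U)`, `log(Ü)` of the multiplicative
coordinate and its square root (p. 21, p. 23 "`log(Ü) := ½ · log(U)`") — the series `Θ̈` of
Prop. 1.4 itself is summed in `ℚ̄_p = PadicAlgCl p`, no extra datum. DATA with printed properties; TODO-merge(abc-iut-L2-t3) for the general Kummer map (plan/LLANA-SPEC N13) and
layer L4 for local class field theory. [cite: MochizukiEtTh2009, Prop 1.5 p.23] -/
structure KummerData where
  /-- `(K^×)^∧`, the profinite completion of `K^×` (p. 23 "`F² … →̃ (K^×)^∧`"). -/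
  KHat : Type
  [instGroupKHat : CommGroup KHat]
  /-- `(K̈^×)^∧` (p. 23 "`F̈² … →̃ (K̈^×)^∧`"; p. 22 "`(L^×)^∧`"). -/
  KddHat : Type
  [instGroupKddHat : CommGroup KddHat]
  /-- `K^× → (K^×)^∧`. -/
  toKHat : (↥D.K)ˣ →* KHat
  /-- `K̈^× → (K̈^×)^∧`; "lie in `L^× ⊆ (L^×)^∧`" (p. 22): injective. -/
  toKddHat : (↥D.Kdd)ˣ →* KddHat
  /-- `K^× ⊆ (K^×)^∧` (p. 30 "we regard `K^× ⊆ (K^×)^∧`"). -/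
  toKHat_injective : Function.Injective toKHat
  /-- `K̈^× ⊆ (K̈^×)^∧` (p. 22). -/
  toKddHat_injective : Function.Injective toKddHat
  /-- `(K^×)^∧ → (K̈^×)^∧` induced by `K ⊆ K̈`. -/
  hatIncl : KHat →* KddHat
  /-- Compatibility of `(K^×)^∧ → (K̈^×)^∧` with `K^× ⊆ K̈^×` (same element of `ℚ̄_p`). -/
  hatIncl_toKHat : ∀ (x : (↥D.K)ˣ) (y : (↥D.Kdd)ˣ),
    ((x : D.K) : PadicAlgCl p) = ((y : D.Kdd) : PadicAlgCl p) → hatIncl (toKHat x) = toKddHat y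
  /-- `(K^×)^∧ ≅ H¹(G_K, Ẑ(1)) ≅ H¹(G_K, Δ_Θ) = F² ⊆ H¹((Π^tp_Y)^Θ, Δ_Θ)` (Prop. 1.5 (i), p. 23), as one
  injection. -/
  kumY : KHat →* D.H1Theta (D.GtpY.map D.toTheta)
  /-- `(K^×)^∧ → H¹((Π^tp_Y)^Θ, Δ_Θ)` is injective (Kummer isomorphism and injectivity of inflation). -/
  kumY_injective : Function.Injective kumY
  /-- `(K̈^×)^∧ ≅ H¹(G_K̈, Ẑ(1)) ≅ H¹(G_K̈, Δ_Θ) = F̈² ⊆ H¹((Π^tp_Ÿ)^Θ, Δ_Θ)` (Prop. 1.5 (ii), p. 23). -/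
  kumYdd : KddHat →* D.H1Theta (D.GtpYdd.map D.toTheta)
  /-- `(K̈^×)^∧ → H¹((Π^tp_Ÿ)^Θ, Δ_Θ)` is injective. -/
  kumYdd_injective : Function.Injective kumYdd
  /-- Restriction from `(Π^tp_Y)^Θ` to `(Π^tp_Ÿ)^Θ` carries the `K`-Kummer classes to the `K̈`-ones. -/
  res_kumY : ∀ x : KHat,
    ContH1.res (MonoidHom.id D.GtpTheta) D.DeltaTheta D.GtpYddTheta_le (kumY x) = kumYdd (hatIncl x)
  /-- **`log(U)`** ∈ `H¹((Π^tp_Y)^Θ, Δ_Θ)`: the Kummer class of "the multiplicative coordinate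
  `U ∈ Γ(U, O^×_U)`" (p. 21), which generates `F¹/F² = Ẑ · log(U)` (p. 23). -/
  logU : D.H1Theta (D.GtpY.map D.toTheta)
  /-- **`log(Ü)`** ∈ `H¹((Π^tp_Ÿ)^Θ, Δ_Θ)`: the Kummer class of the square root "`Ü ∈ Γ(Ü, O^×_Ü)`"
  (p. 21), generating `F̈¹/F̈² = Ẑ · log(Ü)` (p. 23). -/
  logUdd : D.H1Theta (D.GtpYdd.map D.toTheta)
  /-- "`log(Ü) := ½ · log(U)`" (p. 23): `log(U)|_Ÿ = 2 · log(Ü)` (multiplicatively: the square). -/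
  res_logU : ContH1.res (MonoidHom.id D.GtpTheta) D.DeltaTheta D.GtpYddTheta_le logU = logUdd ^ 2

attribute [instance] KummerData.instGroupKHat KummerData.instGroupKddHat

/-- **The data of an étale theta class** (Prop. 1.3, pp. 19–21) over the Kummer data: a class
"without denominators" `η̈^Θ ∈ H¹(Π^tp_Ÿ, Δ_Θ)` (p. 21) — a genuine element of the real `H¹` — together
with the level-`N` classes `η^Θ_N ∈ H¹(Π^tp_Y, Δ_Θ ⊗ ½ℤ/Nℤ)` and their limit
`η^Θ ∈ H¹(Π^tp_Y, ½Δ_Θ)` (p. 20) in ABSTRACT groups (the coefficient modules `Δ_Θ ⊗ ½ℤ/Nℤ`, `½Δ_Θ` have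
no carrier here), with the maps relating them. The printed PROPERTIES are the predicate `Prop13`.
[cite: MochizukiEtTh2009, Prop 1.3 p.20] -/
structure EtaleThetaData extends KummerData D where
  /-- "a class `η̈^Θ ∈ H¹(Π^tp_Ÿ, Δ_Θ)`" (p. 21; Prop. 1.4 (iii), 1.5 (iii)): one member of the set
  `O^×_K̈ · η̈^Θ`. -/
  etaDd : D.H1 D.GtpYdd
  /-- `H¹(Π^tp_Y, Δ_Θ ⊗ (½ℤ/Nℤ)) ≅ H¹(Π^tp_Y, (½ℤ/Nℤ)(1))` (p. 20), `N ≥ 1`, as an abstract group. -/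
  H1YhalfN : ℕ+ → Type
  [instGroupH1YhalfN : ∀ N, CommGroup (H1YhalfN N)]
  /-- "a cohomology class `η^Θ_N ∈ H¹(Π^tp_Y, (½ℤ/Nℤ)(1))`" (p. 20). -/
  etaN : ∀ N, H1YhalfN N
  /-- The action of `O^×_{K/K̈}` on `H¹(Π^tp_Y, (½ℤ/Nℤ)(1))` "via the composite
  `O^×_{K/K̈} → H¹(G_K, (½ℤ/Nℤ)(1)) → H¹(Π^tp_Y, (½ℤ/Nℤ)(1))` — where the first map is the evident
  generalization of the Kummer map" (p. 20). -/
  kumN : ∀ N, D.unitsOKmodKdd →* H1YhalfN N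
  /-- `H¹(Π^tp_Y, ½Δ_Θ)` (p. 20), as an abstract group. -/
  H1Yhalf : Type
  [instGroupH1Yhalf : CommGroup H1Yhalf]
  /-- "by allowing `N` to vary … we obtain … `O^×_{K/K̈} · η^Θ ∈ H¹(Π^tp_Y, ½Δ_Θ)`" (p. 20). -/
  eta : H1Yhalf
  /-- The projections `H¹(Π^tp_Y, ½Δ_Θ) → H¹(Π^tp_Y, Δ_Θ ⊗ ½ℤ/Nℤ)`. -/
  toLevel : ∀ N, H1Yhalf →* H1YhalfN N
  /-- The `O^×_{K/K̈}`-Kummer action on `H¹(Π^tp_Y, ½Δ_Θ)`. -/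
  kumHalf : D.unitsOKmodKdd →* H1Yhalf
  /-- `H¹(Π^tp_Y, Δ_Θ) → H¹(Π^tp_Y, ½Δ_Θ)` induced by `Δ_Θ ↪ ½Δ_Θ` (Rmk. 1.3.1, p. 21). -/
  ofIntegralY : D.H1 D.GtpY →* H1Yhalf
  /-- `H¹(Π^tp_Ÿ, ½Δ_Θ)` (p. 20 bottom), as an abstract group. -/
  H1YddHalf : Type
  [instGroupH1YddHalf : CommGroup H1YddHalf]
  /-- Restriction `H¹(Π^tp_Y, ½Δ_Θ) → H¹(Π^tp_Ÿ, ½Δ_Θ)` ("the restricted classes … `|_Ÿ`", p. 20). -/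
  resHalf : H1Yhalf →* H1YddHalf
  /-- `H¹(Π^tp_Ÿ, Δ_Θ) → H¹(Π^tp_Ÿ, ½Δ_Θ)` induced by `Δ_Θ ↪ ½Δ_Θ` ("arise naturally from classes …
  'without denominators'", p. 21). -/
  ofIntegral : D.H1 D.GtpYdd →* H1YddHalf
  /-- The square relating the four maps commutes: restricting to `Ÿ` after passing to `½Δ_Θ` is
  passing to `½Δ_Θ` after restricting (naturality of restriction in the coefficients). -/
  resHalf_ofIntegralY : ∀ x : D.H1 D.GtpY,
    resHalf (ofIntegralY x) = ofIntegral (ContH1.res D.toTheta D.DeltaTheta D.GtpYdd_le_GtpY x)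
  /-- `H¹(Π^tp_{Z̈_N}, Δ_Θ ⊗ ½ℤ/Nℤ)` (p. 20), `N ≥ 1`, as an abstract group. -/
  H1ZddN : ℕ+ → Type
  [instGroupH1ZddN : ∀ N, CommGroup (H1ZddN N)]
  /-- Restriction `H¹(Π^tp_Y, Δ_Θ ⊗ ½ℤ/Nℤ) → H¹(Π^tp_{Z̈_N}, Δ_Θ ⊗ ½ℤ/Nℤ)` along `Π^tp_{Z̈_N} ≤ Π^tp_Y`
  (p. 20). -/
  resZN : ∀ N, H1YhalfN N →* H1ZddN N

attribute [instance] EtaleThetaData.instGroupH1YhalfN EtaleThetaData.instGroupH1Yhalf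
  EtaleThetaData.instGroupH1YddHalf EtaleThetaData.instGroupH1ZddN

variable {D}

/-- The Kummer classes of `O^×_K̈` in `H¹(Π^tp_Ÿ, Δ_Θ)` ("where `O^×_K̈` acts via the composite of the
Kummer map … with the natural map `H¹(G_K̈, Δ_Θ) → H¹(Π^tp_Ÿ, Δ_Θ)`", p. 21). [cite: MochizukiEtTh2009, Prop 1.3 p.21] -/
def KummerData.kumUnitsYdd (E : D.KummerData) : Subgroup (D.H1 D.GtpYdd) :=
  (D.unitsOKdd.map E.toKddHat).map ((D.inflTheta D.GtpYdd).comp E.kumYdd)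

/-- **The étale theta class(es)**: the set `O^×_K̈ · η̈^Θ ⊆ H¹(Π^tp_Ÿ, Δ_Θ)`; "by abuse of the definite
article, we shall refer to any element of the sets `O^×_{K/K̈} · η^Θ_N`, `O^×_{K/K̈} · η^Θ`, `O^×_K̈ · η̈^Θ`
as the étale theta class" (p. 21). [cite: MochizukiEtTh2009, Prop 1.3 p.21] -/
def EtaleThetaData.thetaClasses (E : D.EtaleThetaData) : Set (D.H1 D.GtpYdd) :=
  {x | ∃ k ∈ E.kumUnitsYdd, x = k * E.etaDd}

/-! ### Proposition 1.3 and Remark 1.3.1 -/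

/-- **Prop. 1.3 (The Étale Theta Class)**, the typeable clauses (pp. 19–21), as a predicate on the
data `E`: (a) compatibility of the level-`N` classes with the limit class and of the Kummer actions
("by allowing `N` to vary", p. 20); (b) "the restricted classes `O^×_{K/K̈} · η^Θ|_Ÿ ∈ H¹(Π^tp_Ÿ, ½Δ_Θ)`
arise naturally from classes `O^×_K̈ · η̈^Θ ∈ H¹(Π^tp_Ÿ, Δ_Θ)` … 'without denominators'" (pp. 20–21);
(c) `η^Θ_N` "arises from a cohomology class `∈ H¹(Π^tp_Y/Π^tp_{Z̈_N}, …)`", i.e. the level-`N`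
class `η^Θ_N` restricts to zero on `Π^tp_{Z̈_N}` (p. 20; the further clause "whose restriction to
`Hom(Δ^tp_{Ÿ_N}/Δ^tp_{Z̈_N}, Δ_Θ ⊗ ½ℤ/Nℤ)` is the natural isomorphism `Δ^tp_{Ÿ_N}/Δ^tp_{Z̈_N} →̃ Δ_Θ ⊗ ℤ/Nℤ`
composed with the inclusion" and, for the limit, "[sic] the natural isomorphism `(Δ^tp_Y)^Θ →̃ Δ_Θ`
with the natural inclusion `Δ_Θ ↪ ½Δ_Θ`" are quoted, see the module READING NOTES; their consistent
content — `η̈^Θ` restricts to `log(Θ)` on `Δ_Θ` — is `ThetaCohomology.Prop15iii`). NOT typed: independence from the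
choices `s₁, s_N, τ_N`. [cite: MochizukiEtTh2009, Prop 1.3 p.20] -/
structure Prop13 (E : D.EtaleThetaData) : Prop where
  /-- `η^Θ_N` is the image of `η^Θ` at level `N` (p. 20). -/
  toLevel_eta : ∀ N, E.toLevel N E.eta = E.etaN N
  /-- The `O^×_{K/K̈}`-actions at level `N` and in the limit agree (p. 20). -/
  toLevel_kum : ∀ N (a : D.unitsOKmodKdd), E.toLevel N (E.kumHalf a) = E.kumN N a
  /-- `η^Θ|_Ÿ` arises from a class `O^×_K̈ · η̈^Θ` "without denominators" (pp. 20–21). -/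
  eta_res_Ydd : ∃ x ∈ E.thetaClasses, E.resHalf E.eta = E.ofIntegral x
  /-- "`η^Θ_N … arises from a cohomology class `∈ H¹(Π^tp_Y/Π^tp_{Z̈_N}, Δ_Θ ⊗ ½ℤ/Nℤ)`" (p. 20) — a
  MOD-`N` statement about the level-`N` class: by inflation–restriction, `η^Θ_N` restricts to the
  trivial class on `Π^tp_{Z̈_N}` (no unit factor; the printed sentence is about `η^Θ_N` itself). -/
  resZN_etaN : ∀ N : ℕ+, E.resZN N (E.etaN N) = 1

/-- **Rmk. 1.3.1** (p. 21): "the denominators `½` in Proposition 1.3 are by no means superfluous" —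
typed as: `η^Θ ∈ H¹(Π^tp_Y, ½Δ_Θ)` is NOT, up to the `O^×_{K/K̈}`-action, in the image of
`H¹(Π^tp_Y, Δ_Θ)`. (Printed reason, not typed: "the divisor `D₁` on `Ÿ` clearly does not descend to `Y`".)
[cite: MochizukiEtTh2009, Rmk 1.3.1 p.21] -/
def Rmk131 (E : D.EtaleThetaData) : Prop :=
  ∀ (a : D.unitsOKmodKdd) (x : D.H1 D.GtpY), E.kumHalf a * E.eta ≠ E.ofIntegralY x

end ThetaSetting

end Literature.AnabelianGeometry.EtaleTheta

end
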